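import Summits.ResolutionOfSingularities.ResolutionOfSingularities.Theorems.EquisingularLiftEquisingularLiftNatCISmoothingLetter
import Summits.ResolutionOfSingularities.ResolutionOfSingularities.Theorems.EquisingularLiftEquisingularLiftNatCISmoothingTraceFlat
import Summits.ResolutionOfSingularities.ResolutionOfSingularities.Theorems.EquisingularLiftEquisingularLiftNatEquinodalNoseRegularAssembly
import Summits.ResolutionOfSingularities.ResolutionOfSingularities.Theorems.EquisingularLiftEquisingularLiftNatEquinodalLiftOfCertResidue
import Summits.ResolutionOfSingularities.ResolutionOfSingularities.Theorems.EquisingularLiftEquisingularLiftNatDeltaConeLift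
import Summits.ResolutionOfSingularities.ResolutionOfSingularities.Theorems.EquisingularLiftEquisingularLiftNatResidueHypDefsE
import HarnessLib

/-!
# [OURS · L1 W4.5(b) · EL♮(3) · D11 «Σ5a ci-DIRECT» SUPPLY, part 3′] ★ `Equinodal.ci_trace_smoothing`: A REDUCED COMPLETE-INTERSECTION TRACE
# `Z = V₊(f₁) ∩ V₊(f₂) ⊂ ℙ³_k` WITH `V₊(f₁)` SMOOTH ALONG `Z` AND FINITE NON-REGULAR LOCUS LIFTS TO A REGULAR, `O`-FLAT `V(𝓦) ⊂ ℙ³_O`, `𝓦·𝒪_{ℙ³_k} = 𝓘⟨Z⟩`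

res-L1-w45b-stub-2 g19 (STUB WORKER 2 of chain w45b), SUPPLY «ci_trace_smoothing» of desk RULING R72a (iii) (default owner; SIGNATURE posted on the cell
bus, file `g19/CITraceSmoothing.SIG.lean` ba92715da9f71d3d).  OURS; NOT a statement of any manuscript ([Hironaka2017] is a candidate under adjudication —
nothing of it is asserted); AI-written, weaker than expert review.  No `sorry`; standard axioms; DEF-FREE; `--supports stmt-ResolutionOfSingularities-20148
--as helper`, counted 0.  EL♮(3) is NOT proved here; resolution in positive characteristic is NOT proved anywhere in this tree.  Customer-independent
banked support: it changes no door text and deals no width.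
WHAT.  Binders: `k` algebraically closed, `O` a DVR, `θ : O ↠ k`, `φ = map θ`, `ℙ³_O` locally Noetherian and regular, `q` proper; a closed `Z ⊂ ℙ³_k` whose
reduced subscheme `Z̃` has FINITE non-regular locus; the ci equation block DOWNSTAIRS read as ✓ `CIModel.ci_trace_and_flat`'s hypotheses (`f₁, f₂`
homogeneous of degrees `d₁, d₂`, relatively prime, `f₂ ≠ 0`, `(f₁, f₂)` radical, `Z = V₊(f₁) ∩ V₊(f₂)`); and (HOST-J) «at every point of `Z` some
`∂_i f₁` does not vanish».  CONCLUSION: `𝓦` on `ℙ³_O` with `V(𝓦)` REGULAR, `V(𝓦) → Spec O` FLAT, `𝓦 · 𝒪_{ℙ³_k} = 𝓘⟨Z⟩`.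
PROOF (the ci smoothing `𝓦_c = (F̃₁, F̃₂ + c·ϖ·M̃)~`).  Lift `f₁, f₂` to forms `F̃₁, F̃₂`; choose a linear form `λ'` missing the finitely many non-regular
points of `Z̃` (✓ `exists_linearForm_forall_notMem`, `k` infinite) and lift `λ'^{d₂}` to `M̃`.  For EVERY `c` the reductions of `(F̃₁, F̃₂ + c ϖ M̃)` are
`(f₁, f₂)`, so ✓ `CIModel.ci_trace_and_flat` (res-L1-w45b-nose-w1, p704449) gives the reduced trace `𝓘⟨Z⟩` and `O`-flatness; under a REGULAR point of
`Z̃` the local ring of `V(𝓦_c)` is regular (✓ `isRegularLocalRing_quotient_stalkIdeal_of_model`); at each of the finitely many other points at most one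
residue class of `c` is bad (part 2c′ ✓ `isRegularLocalRing_quotient_stalkIdeal_or_deg`, its inputs from part 2d′: (HOST-J) ⇒ `Θ_y f₁ ∉ 𝔪_y²`
⇒ `V(F̃₁)` regular over the point and `Θ_x ϖ ∉ (F̃₁)_x + 𝔪_x²`), so some `c₀` is good everywhere; closed points and specialisation as in ✓ W5g /
✓ `planar_trace_smoothing`.  References (method / index only): H. Matsumura, *Commutative Ring Theory* (1986), Thm. 14.2, 23.7, 30.4; R. Hartshorne,
*Algebraic Geometry* (1977), II Prop. 5.9, III Prop. 9.7.
-/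

set_option linter.dupNamespace false -- mandated namespace `Summit.<Summit>.<Problem>` of this single-conjunct summit
set_option linter.overlappingInstances false -- signatures carry `[IsDomain O] [IsDiscreteValuationRing O]`

noncomputable section

open CategoryTheory CategoryTheory.Limits AlgebraicGeometry TopologicalSpace Topology IsLocalRing
open MvPolynomial HomogeneousLocalization
open Literature.AlgebraicGeometry.Resolution
open AlgebraicGeometry.Scheme.IdealSheafData
open Summit.ResolutionOfSingularities.ResolutionOfSingularities.Cruxes.EquisingularLift.StrataSplit

namespace Summit.ResolutionOfSingularities.ResolutionOfSingularities.Cruxes.EquisingularLiftNat.Sections.Equinodal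

open Summit.ResolutionOfSingularities.ResolutionOfSingularities.Cruxes.EquisingularLiftNat.Sections

set_option maxHeartbeats 1600000 in -- long binder list and the assembly
/-- ★ **Σ5a CI SMOOTHING SUPPLY.**  A reduced complete-intersection trace `Z = V₊(f₁) ∩ V₊(f₂) ⊂ ℙ³_k` with `V₊(f₁)` smooth along `Z` and finite
non-regular locus lifts to a REGULAR `O`-FLAT closed subscheme `V(𝓦) ⊂ ℙ³_O` with reduced special fibre `𝓦 · 𝒪_{ℙ³_k} = 𝓘⟨Z⟩`.  See the module docstring.
[cite: Matsumura1987, Thm. 14.2] [cite: Hartshorne1977, III Prop. 9.7] [OURS · Σ5a supply part 3′; counted 0] -/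
theorem ci_trace_smoothing (k : Type) [Field k] [IsAlgClosed k]
    (O : Type) [CommRing O] [IsDomain O] [IsDiscreteValuationRing O] (θ : O →+* k) (hθ : Function.Surjective θ) :
    letI := MvPolynomial.gradedAlgebra (σ := Fin (3 + 1)) (R := O); letI := MvPolynomial.gradedAlgebra (σ := Fin (3 + 1)) (R := k);
    ∀ (φ : MvPolynomial.homogeneousSubmodule (Fin (3 + 1)) O →+*ᵍ MvPolynomial.homogeneousSubmodule (Fin (3 + 1)) k)
      (hφ' : HomogeneousIdeal.irrelevant (MvPolynomial.homogeneousSubmodule (Fin (3 + 1)) k) ≤ (HomogeneousIdeal.irrelevant (MvPolynomial.homogeneousSubmodule (Fin (3 + 1)) O)).map φ), (∀ s, φ s = MvPolynomial.map θ s) →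
      IsLocallyNoetherian (AlgebraicGeometry.Proj (MvPolynomial.homogeneousSubmodule (Fin (3 + 1)) O)) → Literature.AlgebraicGeometry.Resolution.Scheme.IsRegular (AlgebraicGeometry.Proj (MvPolynomial.homogeneousSubmodule (Fin (3 + 1)) O)) → AlgebraicGeometry.IsProper (AlgebraicGeometry.Proj.toSpecZero (MvPolynomial.homogeneousSubmodule (Fin (3 + 1)) O) ≫ AlgebraicGeometry.Spec.map (CommRingCat.ofHom (algebraMap O (MvPolynomial.homogeneousSubmodule (Fin (3 + 1)) O 0)))) →
    -- the door's closed `Z` with FINITE non-regular locus of `Z̃ = redSub Z` ((N1), as in the planar supply)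
    ∀ (Z : Set (Literature.AlgebraicGeometry.Motives.projectiveSpace 3 k).left) (hZ : IsClosed Z),
      Set.Finite {z : ↥(redSub (Literature.AlgebraicGeometry.Motives.projectiveSpace 3 k).left Z hZ) |
        ¬ IsRegularLocalRing ((redSub (Literature.AlgebraicGeometry.Motives.projectiveSpace 3 k).left Z hZ).presheaf.stalk z)} →
    -- the ci equation block DOWNSTAIRS, read exactly as ✓ `CIModel.ci_trace_and_flat`'s hypotheses: `Z = V₊(f₁) ∩ V₊(f₂)`, `f₁, f₂` homogeneous of
    -- degrees `d₁, d₂`, relatively prime, `f₂ ≠ 0`, `(f₁, f₂)` radical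
    ∀ (d₁ d₂ : ℕ) (f₁ f₂ : MvPolynomial (Fin (3 + 1)) k),
      f₁.IsHomogeneous d₁ → f₂.IsHomogeneous d₂ → IsRelPrime f₁ f₂ → f₂ ≠ 0 → (Ideal.span {f₁, f₂}).IsRadical →
      Z = {y : (Literature.AlgebraicGeometry.Motives.projectiveSpace 3 k).left | f₁ ∈ (y : ProjectiveSpectrum (MvPolynomial.homogeneousSubmodule (Fin (3 + 1)) k)).asHomogeneousIdeal ∧ f₂ ∈ (y : ProjectiveSpectrum (MvPolynomial.homogeneousSubmodule (Fin (3 + 1)) k)).asHomogeneousIdeal} →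
      -- (HOST-J): `V₊(f₁)` is smooth along `Z` — some partial derivative of `f₁` is non-zero at every point of `Z`
      (∀ y : (Literature.AlgebraicGeometry.Motives.projectiveSpace 3 k).left, y ∈ Z →
        ∃ i : Fin (3 + 1), MvPolynomial.pderiv i f₁ ∉ (y : ProjectiveSpectrum (MvPolynomial.homogeneousSubmodule (Fin (3 + 1)) k)).asHomogeneousIdeal) →
    ∃ 𝓦 : (AlgebraicGeometry.Proj (MvPolynomial.homogeneousSubmodule (Fin (3 + 1)) O)).IdealSheafData,
      Literature.AlgebraicGeometry.Resolution.Scheme.IsRegular 𝓦.subscheme ∧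
      AlgebraicGeometry.Flat (𝓦.subschemeι ≫ (AlgebraicGeometry.Proj.toSpecZero (MvPolynomial.homogeneousSubmodule (Fin (3 + 1)) O) ≫ AlgebraicGeometry.Spec.map (CommRingCat.ofHom (algebraMap O (MvPolynomial.homogeneousSubmodule (Fin (3 + 1)) O 0))))) ∧
      𝓦.comap (AlgebraicGeometry.Proj.map φ hφ') = vanishingIdeal (⟨Z, hZ⟩ : Closeds (Literature.AlgebraicGeometry.Motives.projectiveSpace 3 k).left) := by
  classical
  letI := MvPolynomial.gradedAlgebra (σ := Fin (3 + 1)) (R := O)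
  letI := MvPolynomial.gradedAlgebra (σ := Fin (3 + 1)) (R := k)
  intro φ hφ' hφ hPnoeth hPreg hqprop Z hZ hfin d₁ d₂ f₁ f₂ hf₁ hf₂ hrel hf₂0 hrad hZeq hJ
  haveI := hPnoeth
  haveI := hqprop
  haveI : Infinite k := inferInstance
  obtain ⟨ϖ, hϖ⟩ := IsDiscreteValuationRing.exists_irreducible O
  -- units and the uniformiser under `θ`
  have hkerθ : RingHom.ker θ = IsLocalRing.maximalIdeal O := ker_eq_maximalIdeal_of_surjective θ hθ
  have hunit : ∀ x : O, θ x ≠ 0 → IsUnit x := fun x hx => by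
    by_contra h
    exact hx (show x ∈ RingHom.ker θ from hkerθ ▸ (h : x ∈ IsLocalRing.maximalIdeal O))
  have hθϖ : θ ϖ = 0 :=
    show ϖ ∈ RingHom.ker θ from hkerθ ▸ (IsLocalRing.mem_maximalIdeal ϖ).mpr hϖ.not_isUnit
  have hθunit : ∀ c₁ c₂ : O, θ c₁ ≠ θ c₂ → IsUnit (c₁ - c₂) := fun c₁ c₂ h => hunit _ (by rwa [map_sub, sub_ne_zero])
  have hφX : ∀ i : Fin (3 + 1), φ (X i) = X i := fun i => by rw [hφ, map_X]
  -- the reduced trace points: `yk zk ∈ Z = V₊(f₁) ∩ V₊(f₂)`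
  have hyZ : ∀ zk : ↥(redSub (Literature.AlgebraicGeometry.Motives.projectiveSpace 3 k).left Z hZ), (redSubι (Literature.AlgebraicGeometry.Motives.projectiveSpace 3 k).left Z hZ zk : (Literature.AlgebraicGeometry.Motives.projectiveSpace 3 k).left) ∈ Z := by
    intro zk
    have h : _ ∈ Set.range (redSubι (Literature.AlgebraicGeometry.Motives.projectiveSpace 3 k).left Z hZ) := ⟨zk, rfl⟩
    rw [Scheme.IdealSheafData.range_subschemeι, Scheme.IdealSheafData.coe_support_vanishingIdeal] at h
    exact h
  have hZsub : Z ⊆ {y : (Literature.AlgebraicGeometry.Motives.projectiveSpace 3 k).left | f₁ ∈ (y : ProjectiveSpectrum (homogeneousSubmodule (Fin (3 + 1)) k)).asHomogeneousIdeal ∧ f₂ ∈ (y : ProjectiveSpectrum (homogeneousSubmodule (Fin (3 + 1)) k)).asHomogeneousIdeal} := hZeq.subset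
  -- standard charts
  have hchart := PlanarSmoothing.exists_mem_basicOpen_X (R := k) (n := 3)
  choose dch hdch using hchart
  have hxch : ∀ y : Proj (homogeneousSubmodule (Fin (3 + 1)) k),
      Proj.map φ hφ' y ∈ Proj.basicOpen (homogeneousSubmodule (Fin (3 + 1)) O) (X (dch y)) := by
    intro y
    rw [Proj.mem_basicOpen]
    change φ (X (dch y)) ∉ y.asHomogeneousIdeal
    rw [hφX]
    exact (Proj.mem_basicOpen _ _ _).mp (hdch y)
  -- the finite non-regular locus and a linear form `λ'` missing it
  set S : Set ↥(redSub (Literature.AlgebraicGeometry.Motives.projectiveSpace 3 k).left Z hZ) := {z | ¬ IsRegularLocalRing ((redSub (Literature.AlgebraicGeometry.Motives.projectiveSpace 3 k).left Z hZ).presheaf.stalk z)} with hSdef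
  obtain ⟨lam, hlam1, hlam⟩ := PlanarSmoothing.exists_linearForm_forall_notMem (n := 3)
    ((fun zk => (redSubι (Literature.AlgebraicGeometry.Motives.projectiveSpace 3 k).left Z hZ zk : (Literature.AlgebraicGeometry.Motives.projectiveSpace 3 k).left)) '' S) (hfin.image _)
  have hlamS : ∀ zk ∈ S, lam ∉ (redSubι (Literature.AlgebraicGeometry.Motives.projectiveSpace 3 k).left Z hZ zk : ProjectiveSpectrum (homogeneousSubmodule (Fin (3 + 1)) k)).asHomogeneousIdeal := fun zk hzk => hlam _ ⟨zk, hzk, rfl⟩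
  -- the lifts `F̃₁` of `f₁` (the letter), `F̃₂` of `f₂`, `M̃` of `λ'^{d₂}`
  obtain ⟨Lt, hLte, hLtm⟩ := exists_isHomogeneous_map_eq_of_surjective θ hθ f₁ hf₁
  obtain ⟨A, hAe, hAm⟩ := exists_isHomogeneous_map_eq_of_surjective θ hθ f₂ hf₂
  have hMbare : (lam ^ d₂).IsHomogeneous d₂ := by
    have h := hlam1.pow d₂
    rwa [one_mul] at h
  obtain ⟨M, hMe, hMm⟩ := exists_isHomogeneous_map_eq_of_surjective θ hθ _ hMbare
  have hLt1 : Lt ∈ homogeneousSubmodule (Fin (3 + 1)) O d₁ := (mem_homogeneousSubmodule _ _).mpr hLte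
  have hA : A ∈ homogeneousSubmodule (Fin (3 + 1)) O d₂ := (mem_homogeneousSubmodule _ _).mpr hAe
  have hM : M ∈ homogeneousSubmodule (Fin (3 + 1)) O d₂ := (mem_homogeneousSubmodule _ _).mpr hMe
  have hφLt : (φ Lt : MvPolynomial (Fin (3 + 1)) k) = f₁ := by rw [hφ, hLtm]
  -- the smoothing family `𝓦_c = (F̃₁, F̃₂ + c·ϖ·M̃)~`
  let W : O → (Proj (homogeneousSubmodule (Fin (3 + 1)) O)).IdealSheafData := fun c =>
    projIdealSheaf (homogeneousSubmodule (Fin (3 + 1)) O) ⟨Ideal.span (Set.range ![Lt, A + C (c * ϖ) * M]),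
      isHomogeneous_span_of_forall_mem _ _ _ (PlanarSmoothing.pair_mem_deg Lt A M hLt1 hA hM (c * ϖ))⟩
  -- (1) reduced trace and flatness for every `c` (✓ `CIModel.ci_trace_and_flat`)
  have hGc : ∀ c : O, MvPolynomial.map θ (A + C (c * ϖ) * M) = f₂ := fun c => by
    rw [map_add, map_mul, map_C, map_mul θ, hθϖ, mul_zero, C_0, zero_mul, add_zero, hAm]
  have hWtf : ∀ c : O, (W c).comap (Proj.map φ hφ') = vanishingIdeal (⟨Z, hZ⟩ : Closeds (Literature.AlgebraicGeometry.Motives.projectiveSpace 3 k).left) ∧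
      Flat ((W c).subschemeι ≫ (Proj.toSpecZero (homogeneousSubmodule (Fin (3 + 1)) O) ≫
        Spec.map (CommRingCat.ofHom (algebraMap O (homogeneousSubmodule (Fin (3 + 1)) O 0))))) := by
    intro c
    have hrel' : IsRelPrime (MvPolynomial.map θ Lt) (MvPolynomial.map θ (A + C (c * ϖ) * M)) := by rw [hLtm, hGc]; exact hrel
    have hne' : MvPolynomial.map θ (A + C (c * ϖ) * M) ≠ 0 := by rw [hGc]; exact hf₂0
    have hrad' : (Ideal.span {MvPolynomial.map θ Lt, MvPolynomial.map θ (A + C (c * ϖ) * M)}).IsRadical := by rw [hLtm, hGc]; exact hrad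
    have hZeq' : Z = {y : Proj (homogeneousSubmodule (Fin (3 + 1)) k) | MvPolynomial.map θ Lt ∈ y.asHomogeneousIdeal ∧
        MvPolynomial.map θ (A + C (c * ϖ) * M) ∈ y.asHomogeneousIdeal} := by rw [hLtm, hGc]; exact hZeq
    exact CIModel.ci_trace_and_flat O θ hθ φ hφ' hφ Lt (A + C (c * ϖ) * M) d₁ d₂ (PlanarSmoothing.pair_mem_deg Lt A M hLt1 hA hM (c * ϖ))
      hrel' hne' hrad' Z hZ hZeq'
  -- (2) memberships at the points `x = g (yk zk)`
  have hxϖ : ∀ y : Proj (homogeneousSubmodule (Fin (3 + 1)) k),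
      (C ϖ : MvPolynomial (Fin (3 + 1)) O) ∈ (Proj.map φ hφ' y).asHomogeneousIdeal := by
    intro y
    change φ (C ϖ) ∈ y.asHomogeneousIdeal
    rw [hφ, map_C, hθϖ, C_0]; exact zero_mem _
  have hf1y : ∀ zk : ↥(redSub (Literature.AlgebraicGeometry.Motives.projectiveSpace 3 k).left Z hZ), (φ Lt : MvPolynomial (Fin (3 + 1)) k) ∈ (redSubι (Literature.AlgebraicGeometry.Motives.projectiveSpace 3 k).left Z hZ zk : ProjectiveSpectrum (homogeneousSubmodule (Fin (3 + 1)) k)).asHomogeneousIdeal :=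
    fun zk => by rw [hφLt]; exact (hZsub (hyZ zk)).1
  have hLtx : ∀ zk : ↥(redSub (Literature.AlgebraicGeometry.Motives.projectiveSpace 3 k).left Z hZ), Lt ∈ (Proj.map φ hφ' (redSubι (Literature.AlgebraicGeometry.Motives.projectiveSpace 3 k).left Z hZ zk)).asHomogeneousIdeal := fun zk => hf1y zk
  have hAx : ∀ zk : ↥(redSub (Literature.AlgebraicGeometry.Motives.projectiveSpace 3 k).left Z hZ), A ∈ (Proj.map φ hφ' (redSubι (Literature.AlgebraicGeometry.Motives.projectiveSpace 3 k).left Z hZ zk)).asHomogeneousIdeal := by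
    intro zk
    change φ A ∈ (redSubι (Literature.AlgebraicGeometry.Motives.projectiveSpace 3 k).left Z hZ zk : ProjectiveSpectrum (homogeneousSubmodule (Fin (3 + 1)) k)).asHomogeneousIdeal
    rw [hφ, hAm]
    exact (hZsub (hyZ zk)).2
  have hMx : ∀ zk ∈ S, M ∉ (Proj.map φ hφ' (redSubι (Literature.AlgebraicGeometry.Motives.projectiveSpace 3 k).left Z hZ zk)).asHomogeneousIdeal := by
    intro zk hzk h
    change φ M ∈ (redSubι (Literature.AlgebraicGeometry.Motives.projectiveSpace 3 k).left Z hZ zk : ProjectiveSpectrum (homogeneousSubmodule (Fin (3 + 1)) k)).asHomogeneousIdeal at h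
    rw [hφ, hMm] at h
    exact hlamS zk hzk ((redSubι (Literature.AlgebraicGeometry.Motives.projectiveSpace 3 k).left Z hZ zk : ProjectiveSpectrum (homogeneousSubmodule (Fin (3 + 1)) k)).isPrime.mem_of_pow_mem d₂ h)
  -- (3) the host input at the points of `Z`: `Θ_y f₁ ∉ 𝔪_y²` from (HOST-J); hence `V(F̃₁)` regular over `x` and `Θ_x ϖ ∉ (F̃₁)_x + 𝔪_x²`
  have hf1sq : ∀ zk : ↥(redSub (Literature.AlgebraicGeometry.Motives.projectiveSpace 3 k).left Z hZ),
      ((Proj (homogeneousSubmodule (Fin (3 + 1)) k)).presheaf.germ (Proj.basicOpen (homogeneousSubmodule (Fin (3 + 1)) k) (X (dch (redSubι (Literature.AlgebraicGeometry.Motives.projectiveSpace 3 k).left Z hZ zk))))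
        (redSubι (Literature.AlgebraicGeometry.Motives.projectiveSpace 3 k).left Z hZ zk) (hdch (redSubι (Literature.AlgebraicGeometry.Motives.projectiveSpace 3 k).left Z hZ zk))).hom
        ((Proj.awayToSection (homogeneousSubmodule (Fin (3 + 1)) k) (X (dch (redSubι (Literature.AlgebraicGeometry.Motives.projectiveSpace 3 k).left Z hZ zk)))).hom
          (mk₁ (homogeneousSubmodule (Fin (3 + 1)) k) (CILift.X_mem_one' (dch (redSubι (Literature.AlgebraicGeometry.Motives.projectiveSpace 3 k).left Z hZ zk))) d₁ (φ Lt) (φ.map_mem hLt1))) ∉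
      maximalIdeal ((Proj (homogeneousSubmodule (Fin (3 + 1)) k)).presheaf.stalk (redSubι (Literature.AlgebraicGeometry.Motives.projectiveSpace 3 k).left Z hZ zk)) ^ 2 := by
    intro zk
    refine PlanarSmoothing.germ_notMem_sq_of_pderiv_notMem (dch _) d₁ (φ Lt) (φ.map_mem hLt1) _ (hdch _) (hf1y zk) ?_
    rw [hφLt]
    exact hJ _ (hyZ zk)
  have hLreg : ∀ zk : ↥(redSub (Literature.AlgebraicGeometry.Motives.projectiveSpace 3 k).left Z hZ),
      ∀ x' : ↥(projIdealSheaf (homogeneousSubmodule (Fin (3 + 1)) O) ⟨Ideal.span (Set.range ![Lt]),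
        isHomogeneous_span_of_forall_mem _ _ _ (PlanarSmoothing.single_mem_deg Lt hLt1)⟩).subscheme,
      (projIdealSheaf (homogeneousSubmodule (Fin (3 + 1)) O) ⟨Ideal.span (Set.range ![Lt]),
        isHomogeneous_span_of_forall_mem _ _ _ (PlanarSmoothing.single_mem_deg Lt hLt1)⟩).subschemeι x' = Proj.map φ hφ' (redSubι (Literature.AlgebraicGeometry.Motives.projectiveSpace 3 k).left Z hZ zk) →
      IsRegularLocalRing ((projIdealSheaf (homogeneousSubmodule (Fin (3 + 1)) O) ⟨Ideal.span (Set.range ![Lt]),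
        isHomogeneous_span_of_forall_mem _ _ _ (PlanarSmoothing.single_mem_deg Lt hLt1)⟩).subscheme.presheaf.stalk x') :=
    fun zk => PlanarSmoothing.isRegularLocalRing_letter_stalk_of_germ_notMem_sq θ (dch _) φ hφ' hφ _ (hdch _) (hxch _) (hPreg _)
      d₁ Lt hLt1 (hLtx zk) (hf1sq zk)
  have hϖL := fun zk : ↥(redSub (Literature.AlgebraicGeometry.Motives.projectiveSpace 3 k).left Z hZ) =>
    PlanarSmoothing.germ_C_varpi_notMem_stalkIdeal_sup_sq_deg hϖ θ hθϖ (dch _) φ hφ' hφ _ (hdch _) (hxch (redSubι (Literature.AlgebraicGeometry.Motives.projectiveSpace 3 k).left Z hZ zk))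
      d₁ Lt hLt1 (hLtx zk) (hf1sq zk)
  -- (4) at the finitely many non-regular points: the bad residues form a finite set; choose `c₀` outside
  set T : Set k := ⋃ zk ∈ S, {a : k | ∃ c : O, θ c = a ∧
      ¬ IsRegularLocalRing (((Proj (homogeneousSubmodule (Fin (3 + 1)) O)).presheaf.stalk
        (Proj.map φ hφ' (redSubι (Literature.AlgebraicGeometry.Motives.projectiveSpace 3 k).left Z hZ zk)) : Type) ⧸
        stalkIdeal (W c) (Proj.map φ hφ' (redSubι (Literature.AlgebraicGeometry.Motives.projectiveSpace 3 k).left Z hZ zk)))} with hTdef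
  have hTfin : T.Finite := by
    refine hfin.biUnion fun zk hzk => Set.Subsingleton.finite ?_
    intro a ha b hb
    obtain ⟨ca, rfl, hca⟩ := ha
    obtain ⟨cb, rfl, hcb⟩ := hb
    by_contra hab
    rcases PlanarSmoothing.isRegularLocalRing_quotient_stalkIdeal_or_deg (dch _) _ (hxch _) (hxϖ _) Lt A M hLt1 hA hM
        (hLtx zk) (hAx zk) (hMx zk hzk) (hLreg zk) (hϖL zk) ca cb (hθunit ca cb hab) with h | h
    · exact hca h
    · exact hcb h
  obtain ⟨a₁, ha₁⟩ := hTfin.infinite_compl.nonempty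
  obtain ⟨c₀, hc₀⟩ := hθ a₁
  have hgood : ∀ zk ∈ S, IsRegularLocalRing (((Proj (homogeneousSubmodule (Fin (3 + 1)) O)).presheaf.stalk
      (Proj.map φ hφ' (redSubι (Literature.AlgebraicGeometry.Motives.projectiveSpace 3 k).left Z hZ zk)) : Type) ⧸
      stalkIdeal (W c₀) (Proj.map φ hφ' (redSubι (Literature.AlgebraicGeometry.Motives.projectiveSpace 3 k).left Z hZ zk))) := by
    intro zk hzk
    by_contra h
    exact ha₁ (Set.mem_biUnion hzk ⟨c₀, hc₀, h⟩)
  -- (5) the assembly: `V(𝓦_{c₀})` is regular (closed points and specialisation, as W5g)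
  refine ⟨W c₀, ?_, (hWtf c₀).2, (hWtf c₀).1⟩
  have hP := ProjectiveAmbientFibre.isPullback_projMap θ φ hφ hθ hφ'
  have hrange : Set.range (Proj.map φ hφ') = (Proj.toSpecZero (homogeneousSubmodule (Fin (3 + 1)) O) ≫
      Spec.map (CommRingCat.ofHom (algebraMap O (homogeneousSubmodule (Fin (3 + 1)) O 0)))) ⁻¹' {IsLocalRing.closedPoint O} := by
    rw [range_eq_preimage_of_isPullback hP, range_specMap_of_surjective_of_field θ hθ]
  haveI : IsClosedImmersion (Spec.map (CommRingCat.ofHom θ)) := IsClosedImmersion.spec_of_surjective _ hθ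
  haveI : IsClosedImmersion (Proj.map φ hφ') := MorphismProperty.IsStableUnderBaseChange.of_isPullback hP.flip inferInstance
  haveI := (hWtf c₀).2
  haveI : CompactSpace ↥(Spec (.of O)) := (inferInstance : CompactSpace (PrimeSpectrum O))
  haveI : CompactSpace ↥(W c₀).subscheme := QuasiCompact.compactSpace_of_compactSpace ((W c₀).subschemeι ≫
    (Proj.toSpecZero (homogeneousSubmodule (Fin (3 + 1)) O) ≫ Spec.map (CommRingCat.ofHom (algebraMap O (homogeneousSubmodule (Fin (3 + 1)) O 0)))))
  intro x
  obtain ⟨z, hxz, hzcl⟩ := exists_specializes_isClosed x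
  have hιzcl : IsClosed ({(W c₀).subschemeι z} : Set (Proj (homogeneousSubmodule (Fin (3 + 1)) O))) := by
    rw [← Set.image_singleton]; exact (W c₀).subschemeι.isClosedMap _ hzcl
  have hqz : (Proj.toSpecZero (homogeneousSubmodule (Fin (3 + 1)) O) ≫
      Spec.map (CommRingCat.ofHom (algebraMap O (homogeneousSubmodule (Fin (3 + 1)) O 0)))) ((W c₀).subschemeι z) =
      IsLocalRing.closedPoint O := by
    have h := apply_eq_closedPoint_of_isClosed ((W c₀).subschemeι ≫ (Proj.toSpecZero (homogeneousSubmodule (Fin (3 + 1)) O) ≫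
      Spec.map (CommRingCat.ofHom (algebraMap O (homogeneousSubmodule (Fin (3 + 1)) O 0))))) hzcl
    rwa [Scheme.Hom.comp_apply] at h
  obtain ⟨y, hy⟩ : (W c₀).subschemeι z ∈ Set.range (Proj.map φ hφ') := by rw [hrange]; exact hqz
  have hyZ' : y ∈ Z := by
    have hmem : y ∈ (((W c₀).comap (Proj.map φ hφ')).support : Set (Proj (homogeneousSubmodule (Fin (3 + 1)) k))) := by
      rw [Scheme.IdealSheafData.support_comap]
      change Proj.map φ hφ' y ∈ ((W c₀).support : Set (Proj (homogeneousSubmodule (Fin (3 + 1)) O)))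
      rw [hy, ← Scheme.IdealSheafData.range_subschemeι]
      exact ⟨z, rfl⟩
    rw [(hWtf c₀).1] at hmem
    change y ∈ ((Scheme.IdealSheafData.vanishingIdeal (⟨Z, hZ⟩ : Closeds (Literature.AlgebraicGeometry.Motives.projectiveSpace 3 k).left)).support : Set (Literature.AlgebraicGeometry.Motives.projectiveSpace 3 k).left) at hmem
    rw [Scheme.IdealSheafData.coe_support_vanishingIdeal] at hmem
    exact hmem
  obtain ⟨zk, hzk⟩ : y ∈ Set.range (redSubι (Literature.AlgebraicGeometry.Motives.projectiveSpace 3 k).left Z hZ) := by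
    rw [Scheme.IdealSheafData.range_subschemeι, Scheme.IdealSheafData.coe_support_vanishingIdeal]; exact hyZ'
  have hquot : IsRegularLocalRing (((Proj (homogeneousSubmodule (Fin (3 + 1)) O)).presheaf.stalk (Proj.map φ hφ' y) : Type) ⧸
      stalkIdeal (W c₀) (Proj.map φ hφ' y)) := by
    by_cases hreg : IsRegularLocalRing ((redSub (Literature.AlgebraicGeometry.Motives.projectiveSpace 3 k).left Z hZ).presheaf.stalk zk)
    · subst hzk
      exact isRegularLocalRing_quotient_stalkIdeal_of_model O k θ hθ _ _ _ hP _ (hWtf c₀).1 zk hreg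
    · rw [← hzk]
      exact hgood zk hreg
  have hz : IsRegularLocalRing ((W c₀).subscheme.presheaf.stalk z) :=
    (isRegularLocalRing_subscheme_stalk_iff_of_eq (W c₀) z _ rfl).mpr (by rw [← hy]; exact hquot)
  exact isRegularLocalRing_stalk_of_specializes hxz hz

end Summit.ResolutionOfSingularities.ResolutionOfSingularities.Cruxes.EquisingularLiftNat.Sections.Equinodal

end
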